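import Summits.HodgeConjecture.HodgeConjecture.Theorems.Ring2WeilCoverageNormCriteria
import Summits.HodgeConjecture.HodgeConjecture.Theorems.Ring2WeilNormObstructionDescentCensus
import HarnessLib

/-!
# Ring 2 · Weil-type family-coverage census (ring2-b04, gen 40) — NORM-CLASS TABLE: the split-special-fibre column, kernel-checked

research route conditional on HC_CM; not a corollary; Q11.4-sentence-2 already refuted in dim ≥ 3.
`HC_CM` (`Theses.RankFourFaces.CMAbelianHodge`, by name) does not occur in this file; no case of the Hodge
conjecture is claimed. Cell `pub-hodge-ring2`, seat `ring2-b04` (gen 40); companion of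
`Ring2WeilCoverageNormCriteria` (the general criteria). This file is the TREE-STATUS column of the census file
`WEIL-FAMILY-COVERAGE.md` §b04: for the imaginary quadratic fields `K = ℚ(√-d)` of the consumer's tables
(pub-hsemireg `target-g6/TARGET-TABLE.md` rows R0–R4, `general-structure/G3-COVERAGE.md` §4) and the representatives
`a` of the discriminant classes met there, it DECIDES in the kernel whether `a ∈ Nm(Kˣ)` — equivalently (Landherr /
van Geemen (5.4.1), `Ring2.WeilCoverage.mk_neg_eq_splitDiscriminantClass_iff_of_odd` / `…_of_even`) whether the
component `(n, K, δ = [(-1)ⁿ a])` is the SPLIT one, i.e. contains a hyperbolic member (`X × X̂`-type, product of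
Weil-type surfaces with hyperbolic `H`, the uniformly weighted `E_Kⁿ × E_Kⁿ`). Each entry is ONE LINE over the
criteria: an explicit representation `a = x² + d y²` (norm), or a descent at one inert / ramified prime (non-norm),
or a quotient of two earlier entries. The values agree with the seat's independent computation
(`census/normclass_b04.py`, Hilbert symbols + witness search) and with pub-hsemireg gs-eng-2's tables (×2).

## Contents (part A; parts B = `Ring2WeilCoverageNormTableB` (`d = 7, 11, 19, 43, 67, 163`) and C = `…TableC` (the further `|T| = 2` representatives) import this file)

* §0 class-level wrappers: `mk_neg_ne_split_of_odd`, `mk_ne_split_of_even`, `mk_neg_eq_split_of_odd`,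
  `mk_eq_split_of_even` (from `a ∉ / ∈ Nm(K_dˣ)` to `[∓a] ≠ / = splitDiscriminantClass n d`).
* §1–§3 the tables for `d = 1, 2, 3` (namespaces `SqrtNeg1`, `SqrtNeg2`, `SqrtNeg3`): for every squarefree
  `a ≤ 15` and the further representatives named in the consumer's rows (`19, 21` / `23` / `17, 22`) EITHER
  `mem_a` (an explicit `a = x² + d y²`) OR `not_mem_a` (descent at one inert or ramified prime, or a quotient) —
  EXCEPT the eleven non-norm statements of these three fields already landed by ring2-b02
  (`Summit.HodgeConjecture.Ring2WeilNormDescent.three_not_mem_norm_one`, `seven_…`, `twentyOne_…_one`;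
  `five_/seven_/thirteen_not_mem_norm_two`; `two_/five_/ten_/eleven_/twentyTwo_not_mem_norm_three`, file
  `Ring2WeilNormObstructionDescentCensus`), which are REUSED BY NAME — a `--` comment marks each reused entry.
* §4 the consumer's sixfold CELL KEYS (`n = 3`, pub-hsemireg TARGET-TABLE §1b) for these fields, literally:
  `sixfold_sqrtNeg1_neg7_ne_split : [(-7 : ℚ)] ≠ splitDiscriminantClass 3 1`, `…neg21…` (row R3),
  `sixfold_sqrtNeg3_neg6/neg10/neg11/neg22_ne_split` (R1/R2 classes), `sixfold_sqrtNeg2_neg5/neg7/neg13_ne_split`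
  (R4), and the split identifications `sixfold_sqrtNeg1_neg2/neg5_eq_split`, `sixfold_sqrtNeg2_neg3_eq_split`,
  `sixfold_sqrtNeg3_neg3/neg7_eq_split` (row R0); the three keys already in the tree — `[(-2)] ≠ split 3 3`
  (`Ring2AbelianAll.NonsplitNormObstruction.negTwo_ne_splitDiscriminantClass`), `[(-3)] ≠ split 3 1` and
  `[(-5)] ≠ split 3 3` (ring2-b02's `negThree_ne_split_three_one`, `negFive_ne_split_three_three`) — are cited in
  comments, not restated.

Sorry-free; axioms standard; no `def`, no named fact; `decide` only on residues modulo primes `≤ 163`.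

## References

* [vanGeemen1994HodgeAV] B. van Geemen, LNM 1594 (1994), 4.14, 5.4 and (5.4.1).
* [Serre1973] J.-P. Serre, A Course in Arithmetic (1973), Ch. III §1, Ch. IV §3.
* [Markman2025SecantWeil] E. Markman, arXiv:2502.03415 (preprint), §1.1.
-/

noncomputable section

set_option linter.dupNamespace false

open Literature.AlgebraicGeometry.Motives
open Literature.AlgebraicGeometry.VanGeemen1994
open Summit.HodgeConjecture.HodgeConjecture.Ring2.Hypotheses

namespace Summit.HodgeConjecture.HodgeConjecture.Ring2.WeilCoverage

/-! ### §0 From norm (non-)membership to the split class -/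

/-- `Units.mk0 (-a) = -(Units.mk0 a)`. research route conditional on HC_CM; not a corollary; Q11.4-sentence-2 already refuted in dim ≥ 3. [folklore] -/
theorem mk0_neg {a : ℚ} (ha : a ≠ 0) : Units.mk0 (-a) (neg_ne_zero.2 ha) = -Units.mk0 a ha :=
  Units.ext rfl

/-- `n` ODD (`g = 2n = 2, 6, 10, …`; `δ = det H = -a`): `a ∉ Nm(K_dˣ)` ⟹ the component `[-a]` is NOT split.
research route conditional on HC_CM; not a corollary; Q11.4-sentence-2 already refuted in dim ≥ 3. [cite: vanGeemen1994HodgeAV, (5.4.1)] -/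
theorem mk_neg_ne_split_of_odd {d n : ℕ} (hn : Odd n) {a : ℚ} (ha : a ≠ 0)
    (h : Units.mk0 a ha ∉ normUnitsSubgroup ℚ (weilField d)) :
    (QuotientGroup.mk (Units.mk0 (-a) (neg_ne_zero.2 ha)) : weilNormResidueGroup d) ≠ splitDiscriminantClass n d := by
  rw [mk0_neg, Ne, mk_neg_eq_splitDiscriminantClass_iff_of_odd hn]
  exact h

/-- `n` ODD: `a ∈ Nm(K_dˣ)` ⟹ the component `[-a]` IS the split one. research route conditional on HC_CM; not a corollary; Q11.4-sentence-2 already refuted in dim ≥ 3. [cite: vanGeemen1994HodgeAV, (5.4.1)] -/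
theorem mk_neg_eq_split_of_odd {d n : ℕ} (hn : Odd n) {a : ℚ} (ha : a ≠ 0)
    (h : Units.mk0 a ha ∈ normUnitsSubgroup ℚ (weilField d)) :
    (QuotientGroup.mk (Units.mk0 (-a) (neg_ne_zero.2 ha)) : weilNormResidueGroup d) = splitDiscriminantClass n d := by
  rw [mk0_neg, mk_neg_eq_splitDiscriminantClass_iff_of_odd hn]
  exact h

/-- `n` EVEN (`g = 2n = 4, 8, 12, …`; `δ = det H = a`): `a ∉ Nm(K_dˣ)` ⟹ the component `[a]` is NOT split.
research route conditional on HC_CM; not a corollary; Q11.4-sentence-2 already refuted in dim ≥ 3. [cite: vanGeemen1994HodgeAV, (5.4.1)] -/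
theorem mk_ne_split_of_even {d n : ℕ} (hn : Even n) {a : ℚ} (ha : a ≠ 0)
    (h : Units.mk0 a ha ∉ normUnitsSubgroup ℚ (weilField d)) :
    (QuotientGroup.mk (Units.mk0 a ha) : weilNormResidueGroup d) ≠ splitDiscriminantClass n d := by
  rw [Ne, mk_eq_splitDiscriminantClass_iff_of_even hn]
  exact h

/-- `n` EVEN: `a ∈ Nm(K_dˣ)` ⟹ the component `[a]` IS the split one. research route conditional on HC_CM; not a corollary; Q11.4-sentence-2 already refuted in dim ≥ 3. [cite: vanGeemen1994HodgeAV, (5.4.1)] -/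
theorem mk_eq_split_of_even {d n : ℕ} (hn : Even n) {a : ℚ} (ha : a ≠ 0)
    (h : Units.mk0 a ha ∈ normUnitsSubgroup ℚ (weilField d)) :
    (QuotientGroup.mk (Units.mk0 a ha) : weilNormResidueGroup d) = splitDiscriminantClass n d := by
  rw [mk_eq_splitDiscriminantClass_iff_of_even hn]
  exact h

/-! ### §1 `K = ℚ(√-1)` (disc -4; ramified {2}; Nm = {a > 0 : every prime ≡ 3 (mod 4) divides a to an even power}) -/

namespace SqrtNeg1

/-- `1 ∈ Nm(ℚ(√-1)ˣ)`: `1 = 1² + 1·0²` — the split class. research route conditional on HC_CM; not a corollary; Q11.4-sentence-2 already refuted in dim ≥ 3. [cite: vanGeemen1994HodgeAV, (5.4.1)] -/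
theorem mem_1 : Units.mk0 (1 : ℚ) (by norm_num) ∈ normUnitsSubgroup ℚ (weilField 1) :=
  mem_normUnitsSubgroup_of_sq_add_mul_sq _ 1 0 (by norm_num)

/-- `2 ∈ Nm(ℚ(√-1)ˣ)`: `2 = 1² + 1·1²`. research route conditional on HC_CM; not a corollary; Q11.4-sentence-2 already refuted in dim ≥ 3. [cite: vanGeemen1994HodgeAV, (5.4.1)] -/
theorem mem_2 : Units.mk0 (2 : ℚ) (by norm_num) ∈ normUnitsSubgroup ℚ (weilField 1) :=
  mem_normUnitsSubgroup_of_sq_add_mul_sq _ 1 1 (by norm_num)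

-- `3 ∉ Nm(ℚ(√-1)ˣ)` (`T(3) = {2, 3}`): in the tree as `Summit.HodgeConjecture.Ring2WeilNormDescent.three_not_mem_norm_one` (ring2-b02, `Ring2WeilNormObstructionDescentCensus`) — reused, not restated.

/-- `5 ∈ Nm(ℚ(√-1)ˣ)`: `5 = 2² + 1·1²`. research route conditional on HC_CM; not a corollary; Q11.4-sentence-2 already refuted in dim ≥ 3. [cite: vanGeemen1994HodgeAV, (5.4.1)] -/
theorem mem_5 : Units.mk0 (5 : ℚ) (by norm_num) ∈ normUnitsSubgroup ℚ (weilField 1) :=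
  mem_normUnitsSubgroup_of_sq_add_mul_sq _ 2 1 (by norm_num)

/-- `6 ∉ Nm(ℚ(√-1)ˣ)`: descent at the inert prime `3` (`-1` is a non-square mod `3`, `3 ∥ 6`); `T(6) = {2, 3}`. research route conditional on HC_CM; not a corollary; Q11.4-sentence-2 already refuted in dim ≥ 3. [cite: Serre1973, Ch. III §1] -/
theorem not_mem_6 : Units.mk0 (6 : ℚ) (by norm_num) ∉ normUnitsSubgroup ℚ (weilField 1) := by
  simpa using natCast_not_mem_normUnitsSubgroup_of_inert (d := 1) (a := 6) (p := 3)
    (by norm_num) (by decide) (by norm_num) (by norm_num) (by norm_num)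

-- `7 ∉ Nm(ℚ(√-1)ˣ)` (`T(7) = {2, 7}`): in the tree as `Summit.HodgeConjecture.Ring2WeilNormDescent.seven_not_mem_norm_one` (ring2-b02, `Ring2WeilNormObstructionDescentCensus`) — reused, not restated.

/-- `10 ∈ Nm(ℚ(√-1)ˣ)`: `10 = 3² + 1·1²`. research route conditional on HC_CM; not a corollary; Q11.4-sentence-2 already refuted in dim ≥ 3. [cite: vanGeemen1994HodgeAV, (5.4.1)] -/
theorem mem_10 : Units.mk0 (10 : ℚ) (by norm_num) ∈ normUnitsSubgroup ℚ (weilField 1) :=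
  mem_normUnitsSubgroup_of_sq_add_mul_sq _ 3 1 (by norm_num)

/-- `11 ∉ Nm(ℚ(√-1)ˣ)`: descent at the inert prime `11` (`-1` is a non-square mod `11`, `11 ∥ 11`); `T(11) = {2, 11}`. research route conditional on HC_CM; not a corollary; Q11.4-sentence-2 already refuted in dim ≥ 3. [cite: Serre1973, Ch. III §1] -/
theorem not_mem_11 : Units.mk0 (11 : ℚ) (by norm_num) ∉ normUnitsSubgroup ℚ (weilField 1) := by
  simpa using natCast_not_mem_normUnitsSubgroup_of_inert (d := 1) (a := 11) (p := 11)
    (by norm_num) (by decide) (by norm_num) (by norm_num) (by norm_num)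

/-- `13 ∈ Nm(ℚ(√-1)ˣ)`: `13 = 3² + 1·2²`. research route conditional on HC_CM; not a corollary; Q11.4-sentence-2 already refuted in dim ≥ 3. [cite: vanGeemen1994HodgeAV, (5.4.1)] -/
theorem mem_13 : Units.mk0 (13 : ℚ) (by norm_num) ∈ normUnitsSubgroup ℚ (weilField 1) :=
  mem_normUnitsSubgroup_of_sq_add_mul_sq _ 3 2 (by norm_num)

/-- `14 ∉ Nm(ℚ(√-1)ˣ)`: descent at the inert prime `7` (`-1` is a non-square mod `7`, `7 ∥ 14`); `T(14) = {2, 7}`. research route conditional on HC_CM; not a corollary; Q11.4-sentence-2 already refuted in dim ≥ 3. [cite: Serre1973, Ch. III §1] -/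
theorem not_mem_14 : Units.mk0 (14 : ℚ) (by norm_num) ∉ normUnitsSubgroup ℚ (weilField 1) := by
  simpa using natCast_not_mem_normUnitsSubgroup_of_inert (d := 1) (a := 14) (p := 7)
    (by norm_num) (by decide) (by norm_num) (by norm_num) (by norm_num)

/-- `15 ∉ Nm(ℚ(√-1)ˣ)`: descent at the inert prime `3` (`-1` is a non-square mod `3`, `3 ∥ 15`); `T(15) = {2, 3}`. research route conditional on HC_CM; not a corollary; Q11.4-sentence-2 already refuted in dim ≥ 3. [cite: Serre1973, Ch. III §1] -/
theorem not_mem_15 : Units.mk0 (15 : ℚ) (by norm_num) ∉ normUnitsSubgroup ℚ (weilField 1) := by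
  simpa using natCast_not_mem_normUnitsSubgroup_of_inert (d := 1) (a := 15) (p := 3)
    (by norm_num) (by decide) (by norm_num) (by norm_num) (by norm_num)

/-- `19 ∉ Nm(ℚ(√-1)ˣ)`: descent at the inert prime `19` (`-1` is a non-square mod `19`, `19 ∥ 19`); `T(19) = {2, 19}`. research route conditional on HC_CM; not a corollary; Q11.4-sentence-2 already refuted in dim ≥ 3. [cite: Serre1973, Ch. III §1] -/
theorem not_mem_19 : Units.mk0 (19 : ℚ) (by norm_num) ∉ normUnitsSubgroup ℚ (weilField 1) := by
  simpa using natCast_not_mem_normUnitsSubgroup_of_inert (d := 1) (a := 19) (p := 19)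
    (by norm_num) (by decide) (by norm_num) (by norm_num) (by norm_num)

-- `21 ∉ Nm(ℚ(√-1)ˣ)` (`T(21) = {3, 7}`): in the tree as `Summit.HodgeConjecture.Ring2WeilNormDescent.twentyOne_not_mem_norm_one` (ring2-b02, `Ring2WeilNormObstructionDescentCensus`) — reused, not restated.

end SqrtNeg1

/-! ### §2 `K = ℚ(√-2)` (disc -8; ramified {2}; inert primes ≡ 5, 7 (mod 8)) -/

namespace SqrtNeg2

/-- `1 ∈ Nm(ℚ(√-2)ˣ)`: `1 = 1² + 2·0²` — the split class. research route conditional on HC_CM; not a corollary; Q11.4-sentence-2 already refuted in dim ≥ 3. [cite: vanGeemen1994HodgeAV, (5.4.1)] -/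
theorem mem_1 : Units.mk0 (1 : ℚ) (by norm_num) ∈ normUnitsSubgroup ℚ (weilField 2) :=
  mem_normUnitsSubgroup_of_sq_add_mul_sq _ 1 0 (by norm_num)

/-- `2 ∈ Nm(ℚ(√-2)ˣ)`: `2 = 0² + 2·1²`. research route conditional on HC_CM; not a corollary; Q11.4-sentence-2 already refuted in dim ≥ 3. [cite: vanGeemen1994HodgeAV, (5.4.1)] -/
theorem mem_2 : Units.mk0 (2 : ℚ) (by norm_num) ∈ normUnitsSubgroup ℚ (weilField 2) :=
  mem_normUnitsSubgroup_of_sq_add_mul_sq _ 0 1 (by norm_num)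

/-- `3 ∈ Nm(ℚ(√-2)ˣ)`: `3 = 1² + 2·1²`. research route conditional on HC_CM; not a corollary; Q11.4-sentence-2 already refuted in dim ≥ 3. [cite: vanGeemen1994HodgeAV, (5.4.1)] -/
theorem mem_3 : Units.mk0 (3 : ℚ) (by norm_num) ∈ normUnitsSubgroup ℚ (weilField 2) :=
  mem_normUnitsSubgroup_of_sq_add_mul_sq _ 1 1 (by norm_num)

-- `5 ∉ Nm(ℚ(√-2)ˣ)` (`T(5) = {2, 5}`): in the tree as `Summit.HodgeConjecture.Ring2WeilNormDescent.five_not_mem_norm_two` (ring2-b02, `Ring2WeilNormObstructionDescentCensus`) — reused, not restated.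

/-- `6 ∈ Nm(ℚ(√-2)ˣ)`: `6 = 2² + 2·1²`. research route conditional on HC_CM; not a corollary; Q11.4-sentence-2 already refuted in dim ≥ 3. [cite: vanGeemen1994HodgeAV, (5.4.1)] -/
theorem mem_6 : Units.mk0 (6 : ℚ) (by norm_num) ∈ normUnitsSubgroup ℚ (weilField 2) :=
  mem_normUnitsSubgroup_of_sq_add_mul_sq _ 2 1 (by norm_num)

-- `7 ∉ Nm(ℚ(√-2)ˣ)` (`T(7) = {2, 7}`): in the tree as `Summit.HodgeConjecture.Ring2WeilNormDescent.seven_not_mem_norm_two` (ring2-b02, `Ring2WeilNormObstructionDescentCensus`) — reused, not restated.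

/-- `10 ∉ Nm(ℚ(√-2)ˣ)`: descent at the inert prime `5` (`-2` is a non-square mod `5`, `5 ∥ 10`); `T(10) = {2, 5}`. research route conditional on HC_CM; not a corollary; Q11.4-sentence-2 already refuted in dim ≥ 3. [cite: Serre1973, Ch. III §1] -/
theorem not_mem_10 : Units.mk0 (10 : ℚ) (by norm_num) ∉ normUnitsSubgroup ℚ (weilField 2) := by
  simpa using natCast_not_mem_normUnitsSubgroup_of_inert (d := 2) (a := 10) (p := 5)
    (by norm_num) (by decide) (by norm_num) (by norm_num) (by norm_num)

/-- `11 ∈ Nm(ℚ(√-2)ˣ)`: `11 = 3² + 2·1²`. research route conditional on HC_CM; not a corollary; Q11.4-sentence-2 already refuted in dim ≥ 3. [cite: vanGeemen1994HodgeAV, (5.4.1)] -/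
theorem mem_11 : Units.mk0 (11 : ℚ) (by norm_num) ∈ normUnitsSubgroup ℚ (weilField 2) :=
  mem_normUnitsSubgroup_of_sq_add_mul_sq _ 3 1 (by norm_num)

-- `13 ∉ Nm(ℚ(√-2)ˣ)` (`T(13) = {2, 13}`): in the tree as `Summit.HodgeConjecture.Ring2WeilNormDescent.thirteen_not_mem_norm_two` (ring2-b02, `Ring2WeilNormObstructionDescentCensus`) — reused, not restated.

/-- `14 ∉ Nm(ℚ(√-2)ˣ)`: descent at the inert prime `7` (`-2` is a non-square mod `7`, `7 ∥ 14`); `T(14) = {2, 7}`. research route conditional on HC_CM; not a corollary; Q11.4-sentence-2 already refuted in dim ≥ 3. [cite: Serre1973, Ch. III §1] -/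
theorem not_mem_14 : Units.mk0 (14 : ℚ) (by norm_num) ∉ normUnitsSubgroup ℚ (weilField 2) := by
  simpa using natCast_not_mem_normUnitsSubgroup_of_inert (d := 2) (a := 14) (p := 7)
    (by norm_num) (by decide) (by norm_num) (by norm_num) (by norm_num)

/-- `15 ∉ Nm(ℚ(√-2)ˣ)`: descent at the inert prime `5` (`-2` is a non-square mod `5`, `5 ∥ 15`); `T(15) = {2, 5}`. research route conditional on HC_CM; not a corollary; Q11.4-sentence-2 already refuted in dim ≥ 3. [cite: Serre1973, Ch. III §1] -/
theorem not_mem_15 : Units.mk0 (15 : ℚ) (by norm_num) ∉ normUnitsSubgroup ℚ (weilField 2) := by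
  simpa using natCast_not_mem_normUnitsSubgroup_of_inert (d := 2) (a := 15) (p := 5)
    (by norm_num) (by decide) (by norm_num) (by norm_num) (by norm_num)

/-- `23 ∉ Nm(ℚ(√-2)ˣ)`: descent at the inert prime `23` (`-2` is a non-square mod `23`, `23 ∥ 23`); `T(23) = {2, 23}`. research route conditional on HC_CM; not a corollary; Q11.4-sentence-2 already refuted in dim ≥ 3. [cite: Serre1973, Ch. III §1] -/
theorem not_mem_23 : Units.mk0 (23 : ℚ) (by norm_num) ∉ normUnitsSubgroup ℚ (weilField 2) := by
  simpa using natCast_not_mem_normUnitsSubgroup_of_inert (d := 2) (a := 23) (p := 23)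
    (by norm_num) (by decide) (by norm_num) (by norm_num) (by norm_num)

end SqrtNeg2

/-! ### §3 `K = ℚ(√-3)` (disc -3; ramified {3}; inert primes ≡ 2 (mod 3)) -/

namespace SqrtNeg3

/-- `1 ∈ Nm(ℚ(√-3)ˣ)`: `1 = 1² + 3·0²` — the split class. research route conditional on HC_CM; not a corollary; Q11.4-sentence-2 already refuted in dim ≥ 3. [cite: vanGeemen1994HodgeAV, (5.4.1)] -/
theorem mem_1 : Units.mk0 (1 : ℚ) (by norm_num) ∈ normUnitsSubgroup ℚ (weilField 3) :=
  mem_normUnitsSubgroup_of_sq_add_mul_sq _ 1 0 (by norm_num)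

-- `2 ∉ Nm(ℚ(√-3)ˣ)` (`T(2) = {2, 3}`): in the tree as `Summit.HodgeConjecture.Ring2WeilNormDescent.two_not_mem_norm_three` (ring2-b02, `Ring2WeilNormObstructionDescentCensus`) — reused, not restated.

/-- `3 ∈ Nm(ℚ(√-3)ˣ)`: `3 = 0² + 3·1²`. research route conditional on HC_CM; not a corollary; Q11.4-sentence-2 already refuted in dim ≥ 3. [cite: vanGeemen1994HodgeAV, (5.4.1)] -/
theorem mem_3 : Units.mk0 (3 : ℚ) (by norm_num) ∈ normUnitsSubgroup ℚ (weilField 3) :=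
  mem_normUnitsSubgroup_of_sq_add_mul_sq _ 0 1 (by norm_num)

-- `5 ∉ Nm(ℚ(√-3)ˣ)` (`T(5) = {3, 5}`): in the tree as `Summit.HodgeConjecture.Ring2WeilNormDescent.five_not_mem_norm_three` (ring2-b02, `Ring2WeilNormObstructionDescentCensus`) — reused, not restated.

/-- `6 ∉ Nm(ℚ(√-3)ˣ)`: `6 = 3·2` with `3` a norm and `2` not (the norm group is a subgroup); `T(6) = {2, 3}`. research route conditional on HC_CM; not a corollary; Q11.4-sentence-2 already refuted in dim ≥ 3. [cite: vanGeemen1994HodgeAV, 4.14] -/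
theorem not_mem_6 : Units.mk0 (6 : ℚ) (by norm_num) ∉ normUnitsSubgroup ℚ (weilField 3) := by
  have h := mul_not_mem_normUnitsSubgroup mem_3 Summit.HodgeConjecture.Ring2WeilNormDescent.two_not_mem_norm_three
  rw [mk0_mul_mk0] at h
  norm_num at h
  exact h

/-- `7 ∈ Nm(ℚ(√-3)ˣ)`: `7 = 2² + 3·1²`. research route conditional on HC_CM; not a corollary; Q11.4-sentence-2 already refuted in dim ≥ 3. [cite: vanGeemen1994HodgeAV, (5.4.1)] -/
theorem mem_7 : Units.mk0 (7 : ℚ) (by norm_num) ∈ normUnitsSubgroup ℚ (weilField 3) :=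
  mem_normUnitsSubgroup_of_sq_add_mul_sq _ 2 1 (by norm_num)

-- `10 ∉ Nm(ℚ(√-3)ˣ)` (`T(10) = {2, 5}`): in the tree as `Summit.HodgeConjecture.Ring2WeilNormDescent.ten_not_mem_norm_three` (ring2-b02, `Ring2WeilNormObstructionDescentCensus`) — reused, not restated.

-- `11 ∉ Nm(ℚ(√-3)ˣ)` (`T(11) = {3, 11}`): in the tree as `Summit.HodgeConjecture.Ring2WeilNormDescent.eleven_not_mem_norm_three` (ring2-b02, `Ring2WeilNormObstructionDescentCensus`) — reused, not restated.

/-- `13 ∈ Nm(ℚ(√-3)ˣ)`: `13 = 1² + 3·2²`. research route conditional on HC_CM; not a corollary; Q11.4-sentence-2 already refuted in dim ≥ 3. [cite: vanGeemen1994HodgeAV, (5.4.1)] -/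
theorem mem_13 : Units.mk0 (13 : ℚ) (by norm_num) ∈ normUnitsSubgroup ℚ (weilField 3) :=
  mem_normUnitsSubgroup_of_sq_add_mul_sq _ 1 2 (by norm_num)

/-- `14 ∉ Nm(ℚ(√-3)ˣ)`: descent at the ramified prime `3` (`3 ∥ 3`, `14` is a non-square mod `3`); `T(14) = {2, 3}`. research route conditional on HC_CM; not a corollary; Q11.4-sentence-2 already refuted in dim ≥ 3. [cite: Serre1973, Ch. III §1] -/
theorem not_mem_14 : Units.mk0 (14 : ℚ) (by norm_num) ∉ normUnitsSubgroup ℚ (weilField 3) := by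
  simpa using natCast_not_mem_normUnitsSubgroup_of_ramified (d := 3) (a := 14) (p := 3)
    (by norm_num) (by norm_num) (by norm_num) (by decide) (by norm_num)

/-- `15 ∉ Nm(ℚ(√-3)ˣ)`: descent at the inert prime `5` (`-3` is a non-square mod `5`, `5 ∥ 15`); `T(15) = {3, 5}`. research route conditional on HC_CM; not a corollary; Q11.4-sentence-2 already refuted in dim ≥ 3. [cite: Serre1973, Ch. III §1] -/
theorem not_mem_15 : Units.mk0 (15 : ℚ) (by norm_num) ∉ normUnitsSubgroup ℚ (weilField 3) := by
  simpa using natCast_not_mem_normUnitsSubgroup_of_inert (d := 3) (a := 15) (p := 5)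
    (by norm_num) (by decide) (by norm_num) (by norm_num) (by norm_num)

/-- `17 ∉ Nm(ℚ(√-3)ˣ)`: descent at the ramified prime `3` (`3 ∥ 3`, `17` is a non-square mod `3`); `T(17) = {3, 17}`. research route conditional on HC_CM; not a corollary; Q11.4-sentence-2 already refuted in dim ≥ 3. [cite: Serre1973, Ch. III §1] -/
theorem not_mem_17 : Units.mk0 (17 : ℚ) (by norm_num) ∉ normUnitsSubgroup ℚ (weilField 3) := by
  simpa using natCast_not_mem_normUnitsSubgroup_of_ramified (d := 3) (a := 17) (p := 3)
    (by norm_num) (by norm_num) (by norm_num) (by decide) (by norm_num)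

-- `22 ∉ Nm(ℚ(√-3)ˣ)` (`T(22) = {2, 11}`): in the tree as `Summit.HodgeConjecture.Ring2WeilNormDescent.twentyTwo_not_mem_norm_three` (ring2-b02, `Ring2WeilNormObstructionDescentCensus`) — reused, not restated.

end SqrtNeg3

/-! ### §4 The consumer's cell keys at `n = 3` (abelian sixfolds; pub-hsemireg TARGET-TABLE §1b), fields `ℚ(i)`, `ℚ(√-2)`, `ℚ(√-3)` -/

/-- Row R0 (ℚ(i): a = 2 ≡ 1): `[(-2 : ℚ)] = splitDiscriminantClass 3 1` — the sixfold component `(3, ℚ(√-1), δ = [-2])` IS the split one (contains the hyperbolic members). research route conditional on HC_CM; not a corollary; Q11.4-sentence-2 already refuted in dim ≥ 3. [cite: vanGeemen1994HodgeAV, (5.4.1)] -/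
theorem sixfold_sqrtNeg1_neg2_eq_split :
    (QuotientGroup.mk (Units.mk0 (-2 : ℚ) (by norm_num)) : weilNormResidueGroup 1) = splitDiscriminantClass 3 1 :=
  mk_neg_eq_split_of_odd (by decide) _ SqrtNeg1.mem_2

/-- Row R0 (ℚ(i): a = 5 ≡ 1): `[(-5 : ℚ)] = splitDiscriminantClass 3 1` — the sixfold component `(3, ℚ(√-1), δ = [-5])` IS the split one (contains the hyperbolic members). research route conditional on HC_CM; not a corollary; Q11.4-sentence-2 already refuted in dim ≥ 3. [cite: vanGeemen1994HodgeAV, (5.4.1)] -/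
theorem sixfold_sqrtNeg1_neg5_eq_split :
    (QuotientGroup.mk (Units.mk0 (-5 : ℚ) (by norm_num)) : weilNormResidueGroup 1) = splitDiscriminantClass 3 1 :=
  mk_neg_eq_split_of_odd (by decide) _ SqrtNeg1.mem_5

-- Row R3: the key `[(-3 : ℚ)] ≠ splitDiscriminantClass 3 1` is ALREADY in the tree as `Summit.HodgeConjecture.Ring2WeilNormDescent.negThree_ne_split_three_one` — not restated.

/-- Row R3: `[(-7 : ℚ)] ≠ splitDiscriminantClass 3 1` — the sixfold component `(3, ℚ(√-1), δ = [-7])` is NON-split (no hyperbolic / `X × X̂`-type / uniformly weighted `E_K³ × E_K³` member). research route conditional on HC_CM; not a corollary; Q11.4-sentence-2 already refuted in dim ≥ 3. [cite: vanGeemen1994HodgeAV, (5.4.1)] -/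
theorem sixfold_sqrtNeg1_neg7_ne_split :
    (QuotientGroup.mk (Units.mk0 (-7 : ℚ) (by norm_num)) : weilNormResidueGroup 1) ≠ splitDiscriminantClass 3 1 :=
  mk_neg_ne_split_of_odd (by decide) _ Summit.HodgeConjecture.Ring2WeilNormDescent.seven_not_mem_norm_one

/-- Row R3 / R5 key (ℚ(i), T = {3,7}): `[(-21 : ℚ)] ≠ splitDiscriminantClass 3 1` — the sixfold component `(3, ℚ(√-1), δ = [-21])` is NON-split (no hyperbolic / `X × X̂`-type / uniformly weighted `E_K³ × E_K³` member). research route conditional on HC_CM; not a corollary; Q11.4-sentence-2 already refuted in dim ≥ 3. [cite: vanGeemen1994HodgeAV, (5.4.1)] -/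
theorem sixfold_sqrtNeg1_neg21_ne_split :
    (QuotientGroup.mk (Units.mk0 (-21 : ℚ) (by norm_num)) : weilNormResidueGroup 1) ≠ splitDiscriminantClass 3 1 :=
  mk_neg_ne_split_of_odd (by decide) _ Summit.HodgeConjecture.Ring2WeilNormDescent.twentyOne_not_mem_norm_one

/-- Row R0 (ℚ(√-2): a = 3 ≡ 1): `[(-3 : ℚ)] = splitDiscriminantClass 3 2` — the sixfold component `(3, ℚ(√-2), δ = [-3])` IS the split one (contains the hyperbolic members). research route conditional on HC_CM; not a corollary; Q11.4-sentence-2 already refuted in dim ≥ 3. [cite: vanGeemen1994HodgeAV, (5.4.1)] -/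
theorem sixfold_sqrtNeg2_neg3_eq_split :
    (QuotientGroup.mk (Units.mk0 (-3 : ℚ) (by norm_num)) : weilNormResidueGroup 2) = splitDiscriminantClass 3 2 :=
  mk_neg_eq_split_of_odd (by decide) _ SqrtNeg2.mem_3

/-- Row R4: `[(-5 : ℚ)] ≠ splitDiscriminantClass 3 2` — the sixfold component `(3, ℚ(√-2), δ = [-5])` is NON-split (no hyperbolic / `X × X̂`-type / uniformly weighted `E_K³ × E_K³` member). research route conditional on HC_CM; not a corollary; Q11.4-sentence-2 already refuted in dim ≥ 3. [cite: vanGeemen1994HodgeAV, (5.4.1)] -/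
theorem sixfold_sqrtNeg2_neg5_ne_split :
    (QuotientGroup.mk (Units.mk0 (-5 : ℚ) (by norm_num)) : weilNormResidueGroup 2) ≠ splitDiscriminantClass 3 2 :=
  mk_neg_ne_split_of_odd (by decide) _ Summit.HodgeConjecture.Ring2WeilNormDescent.five_not_mem_norm_two

/-- Row R4: `[(-7 : ℚ)] ≠ splitDiscriminantClass 3 2` — the sixfold component `(3, ℚ(√-2), δ = [-7])` is NON-split (no hyperbolic / `X × X̂`-type / uniformly weighted `E_K³ × E_K³` member). research route conditional on HC_CM; not a corollary; Q11.4-sentence-2 already refuted in dim ≥ 3. [cite: vanGeemen1994HodgeAV, (5.4.1)] -/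
theorem sixfold_sqrtNeg2_neg7_ne_split :
    (QuotientGroup.mk (Units.mk0 (-7 : ℚ) (by norm_num)) : weilNormResidueGroup 2) ≠ splitDiscriminantClass 3 2 :=
  mk_neg_ne_split_of_odd (by decide) _ Summit.HodgeConjecture.Ring2WeilNormDescent.seven_not_mem_norm_two

/-- Row R4: `[(-13 : ℚ)] ≠ splitDiscriminantClass 3 2` — the sixfold component `(3, ℚ(√-2), δ = [-13])` is NON-split (no hyperbolic / `X × X̂`-type / uniformly weighted `E_K³ × E_K³` member). research route conditional on HC_CM; not a corollary; Q11.4-sentence-2 already refuted in dim ≥ 3. [cite: vanGeemen1994HodgeAV, (5.4.1)] -/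
theorem sixfold_sqrtNeg2_neg13_ne_split :
    (QuotientGroup.mk (Units.mk0 (-13 : ℚ) (by norm_num)) : weilNormResidueGroup 2) ≠ splitDiscriminantClass 3 2 :=
  mk_neg_ne_split_of_odd (by decide) _ Summit.HodgeConjecture.Ring2WeilNormDescent.thirteen_not_mem_norm_two

/-- Row R0 (ℚ(√-3): a = 3 ≡ 1): `[(-3 : ℚ)] = splitDiscriminantClass 3 3` — the sixfold component `(3, ℚ(√-3), δ = [-3])` IS the split one (contains the hyperbolic members). research route conditional on HC_CM; not a corollary; Q11.4-sentence-2 already refuted in dim ≥ 3. [cite: vanGeemen1994HodgeAV, (5.4.1)] -/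
theorem sixfold_sqrtNeg3_neg3_eq_split :
    (QuotientGroup.mk (Units.mk0 (-3 : ℚ) (by norm_num)) : weilNormResidueGroup 3) = splitDiscriminantClass 3 3 :=
  mk_neg_eq_split_of_odd (by decide) _ SqrtNeg3.mem_3

/-- Row R0 (ℚ(√-3): a = 7 ≡ 1): `[(-7 : ℚ)] = splitDiscriminantClass 3 3` — the sixfold component `(3, ℚ(√-3), δ = [-7])` IS the split one (contains the hyperbolic members). research route conditional on HC_CM; not a corollary; Q11.4-sentence-2 already refuted in dim ≥ 3. [cite: vanGeemen1994HodgeAV, (5.4.1)] -/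
theorem sixfold_sqrtNeg3_neg7_eq_split :
    (QuotientGroup.mk (Units.mk0 (-7 : ℚ) (by norm_num)) : weilNormResidueGroup 3) = splitDiscriminantClass 3 3 :=
  mk_neg_eq_split_of_odd (by decide) _ SqrtNeg3.mem_7

-- Row R1 (the anchor class of record): the key `[(-2 : ℚ)] ≠ splitDiscriminantClass 3 3` is ALREADY in the tree as `Summit.HodgeConjecture.Ring2AbelianAll.NonsplitNormObstruction.negTwo_ne_splitDiscriminantClass` — not restated.

-- Row R2: the key `[(-5 : ℚ)] ≠ splitDiscriminantClass 3 3` is ALREADY in the tree as `Summit.HodgeConjecture.Ring2WeilNormDescent.negFive_ne_split_three_three` — not restated.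

/-- Row R2 (6 ≡ 2: same class as R1): `[(-6 : ℚ)] ≠ splitDiscriminantClass 3 3` — the sixfold component `(3, ℚ(√-3), δ = [-6])` is NON-split (no hyperbolic / `X × X̂`-type / uniformly weighted `E_K³ × E_K³` member). research route conditional on HC_CM; not a corollary; Q11.4-sentence-2 already refuted in dim ≥ 3. [cite: vanGeemen1994HodgeAV, (5.4.1)] -/
theorem sixfold_sqrtNeg3_neg6_ne_split :
    (QuotientGroup.mk (Units.mk0 (-6 : ℚ) (by norm_num)) : weilNormResidueGroup 3) ≠ splitDiscriminantClass 3 3 :=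
  mk_neg_ne_split_of_odd (by decide) _ SqrtNeg3.not_mem_6

/-- Row R2: `[(-10 : ℚ)] ≠ splitDiscriminantClass 3 3` — the sixfold component `(3, ℚ(√-3), δ = [-10])` is NON-split (no hyperbolic / `X × X̂`-type / uniformly weighted `E_K³ × E_K³` member). research route conditional on HC_CM; not a corollary; Q11.4-sentence-2 already refuted in dim ≥ 3. [cite: vanGeemen1994HodgeAV, (5.4.1)] -/
theorem sixfold_sqrtNeg3_neg10_ne_split :
    (QuotientGroup.mk (Units.mk0 (-10 : ℚ) (by norm_num)) : weilNormResidueGroup 3) ≠ splitDiscriminantClass 3 3 :=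
  mk_neg_ne_split_of_odd (by decide) _ Summit.HodgeConjecture.Ring2WeilNormDescent.ten_not_mem_norm_three

/-- Row R2: `[(-11 : ℚ)] ≠ splitDiscriminantClass 3 3` — the sixfold component `(3, ℚ(√-3), δ = [-11])` is NON-split (no hyperbolic / `X × X̂`-type / uniformly weighted `E_K³ × E_K³` member). research route conditional on HC_CM; not a corollary; Q11.4-sentence-2 already refuted in dim ≥ 3. [cite: vanGeemen1994HodgeAV, (5.4.1)] -/
theorem sixfold_sqrtNeg3_neg11_ne_split :
    (QuotientGroup.mk (Units.mk0 (-11 : ℚ) (by norm_num)) : weilNormResidueGroup 3) ≠ splitDiscriminantClass 3 3 :=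
  mk_neg_ne_split_of_odd (by decide) _ Summit.HodgeConjecture.Ring2WeilNormDescent.eleven_not_mem_norm_three

/-- Row R2: `[(-22 : ℚ)] ≠ splitDiscriminantClass 3 3` — the sixfold component `(3, ℚ(√-3), δ = [-22])` is NON-split (no hyperbolic / `X × X̂`-type / uniformly weighted `E_K³ × E_K³` member). research route conditional on HC_CM; not a corollary; Q11.4-sentence-2 already refuted in dim ≥ 3. [cite: vanGeemen1994HodgeAV, (5.4.1)] -/
theorem sixfold_sqrtNeg3_neg22_ne_split :
    (QuotientGroup.mk (Units.mk0 (-22 : ℚ) (by norm_num)) : weilNormResidueGroup 3) ≠ splitDiscriminantClass 3 3 :=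
  mk_neg_ne_split_of_odd (by decide) _ Summit.HodgeConjecture.Ring2WeilNormDescent.twentyTwo_not_mem_norm_three

end Summit.HodgeConjecture.HodgeConjecture.Ring2.WeilCoverage

end
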